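import Summits.Ventures.HodgeRepro2.T5NormUnitsHensel
import Summits.Ventures.HodgeRepro2.T5AdicCompletionHenselian
import Summits.Ventures.HodgeRepro2.T5InertPlaceCompletionLattice

/-!
# T5InertPlaceCompletionIsotropy — the norm theorem for units and the isotropy of every
unimodular hermitian 3-space ON THE RECORD'S LOCAL FIELDS

Tier-5 kernel support (N3, the inert places) — p8, gen 15.  §8(d): uses an L-value-free
non-vanishing device: NO.

`T5NormUnitsHensel` proved, on an abstract henselian DVR base, the norm theorem for units of an
unramified quadratic extension (`N(𝒪_E^×) = 𝒪_F^×`, Serre, Local Fields V §2 Prop. 3) and with it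
that every hermitian `3 × 3` matrix with unit determinant has a non-zero isotropic vector.  On
Mathlib's completions `(O_Kv, K_v, L_w)` of number fields at `w ∣ v` the henselian hypothesis is
`T5AdicCompletionHenselian.henselianLocalRing` (p4), the locality of `𝒪_{E_v} = integralClosure
O_Kv L_w` is `T5InertPlaceCompletion.isLocalRing_integralClosure_adicCompletion`, and the finite
residue field is `T5AdicCompletionResidueField`'s instance — so both statements instantiate with
the same two local hypotheses every inert-place row takes (`[L_w : K_v] = 2`, a uniformiser `ϖ`
of `O_Kv` staying one in `O_Lw`) and the Galois conjugation `σ ≠ 1`: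
* `exists_isInteger_conj_mul_eq_unit_adicCompletion` — every unit of `O_Kv` is `σ z · z` for some
  `z ∈ 𝒪_{E_v}`;
* `exists_isotropic_adicCompletion` — every `σ`-hermitian `H` over `L_w` with `IsUnit H.det` has a
  non-zero isotropic vector: the «isotropy of `V_v` (printed)» cell of CHECK-N3 §§22–28 CLOSED on
  the record's local fields;
* hence (u3) and the commutativity of `H(U(H), K_H)` WITHOUT an isotropy hypothesis:
  `exists_dualLattice_eq_iff_exists_det_eq_mul_zpow_of_isUnit_det` (both lattice spellings) and
  `heckeAlgebra_mul_comm_of_isUnit_det`.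

Nothing here asserts which `H` is the datum's Gram matrix or which self-dual lattice the record
takes.
-/

namespace Summit.Ventures.HodgeRepro2.T5InertPlaceCompletionIsotropy

open IsDedekindDomain HeightOneSpectrum NumberField

variable {K : Type*} [Field K] [NumberField K] (v : HeightOneSpectrum (RingOfIntegers K))
variable {L : Type*} [Field L] [NumberField L] [Algebra K L]
  (w : HeightOneSpectrum (RingOfIntegers L)) [w.asIdeal.LiesOver v.asIdeal]

/-- THE NORM THEOREM FOR UNITS ON THE RECORD'S LOCAL FIELDS: at an inert place, every unit `u` of
`O_Kv` is `σ z · z` for some `z` integral over `O_Kv` in `L_w` (`T5NormUnitsHensel` with p4's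
henselian instance for `O_Kv`). -/
theorem exists_isInteger_conj_mul_eq_unit_adicCompletion
    (h2 : Module.finrank (v.adicCompletion K) (w.adicCompletion L) = 2)
    {ϖ : v.adicCompletionIntegers K} (hϖ : Irreducible ϖ)
    (hinert : Irreducible (algebraMap (v.adicCompletionIntegers K) (w.adicCompletionIntegers L) ϖ))
    (σ : w.adicCompletion L ≃ₐ[v.adicCompletion K] w.adicCompletion L) (hσ : σ ≠ 1)
    (u : (v.adicCompletionIntegers K)ˣ) :
    ∃ z : w.adicCompletion L,
      IsLocalization.IsInteger (integralClosure (v.adicCompletionIntegers K) (w.adicCompletion L)) z ∧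
        σ z * z = algebraMap (v.adicCompletionIntegers K) (w.adicCompletion L) u := by
  haveI := T5AdicCompletionHenselian.henselianLocalRing v
  haveI := T5InertPlaceCompletion.isLocalRing_integralClosure_adicCompletion v w
  exact T5NormUnitsHensel.exists_isInteger_conj_mul_eq_unit h2 σ hσ
    (T5InertPlaceCompletion.map_maximalIdeal_integralClosure_eq_of_irreducible v w hϖ hinert) u

/-- THE ISOTROPY OF `V_v` ON THE RECORD'S LOCAL FIELDS: at an inert place every `σ`-hermitian
`3 × 3` matrix over `L_w` with unit determinant has a non-zero isotropic vector
(`T5NormUnitsHensel.exists_isotropic_of_henselian` on `(O_Kv, K_v, L_w)`). -/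
theorem exists_isotropic_adicCompletion
    (h2 : Module.finrank (v.adicCompletion K) (w.adicCompletion L) = 2)
    {ϖ : v.adicCompletionIntegers K} (hϖ : Irreducible ϖ)
    (hinert : Irreducible (algebraMap (v.adicCompletionIntegers K) (w.adicCompletionIntegers L) ϖ))
    (σ : w.adicCompletion L ≃ₐ[v.adicCompletion K] w.adicCompletion L) (hσ : σ ≠ 1) :
    letI := T5StarOfInvolution.starRingOfQuadratic h2 σ hσ
    ∀ {H : Matrix (Fin 3) (Fin 3) (w.adicCompletion L)}, H.IsHermitian → IsUnit H.det →
      ∃ x : Fin 3 → w.adicCompletion L, x ≠ 0 ∧ T5UnitaryGroupIsometry.sesqForm H x x = 0 := by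
  haveI := T5AdicCompletionHenselian.henselianLocalRing v
  haveI := T5InertPlaceCompletion.isLocalRing_integralClosure_adicCompletion v w
  intro H hH hdet
  exact T5NormUnitsHensel.exists_isotropic_of_henselian h2 σ hσ
    (T5InertPlaceCompletion.map_maximalIdeal_integralClosure_eq_of_irreducible v w hϖ hinert) hϖ
    hH hdet

/-- (u3) on the record's local fields WITHOUT an isotropy hypothesis: `(L_w³, H)` admits a
self-dual `𝒪_{E_v}`-lattice iff `det H = a · ϖ^{2m}`, `a ∈ O_Kvˣ`, for every `σ`-hermitian `H`
with unit determinant. -/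
theorem exists_dualLattice_eq_iff_exists_det_eq_mul_zpow_of_isUnit_det
    (h2 : Module.finrank (v.adicCompletion K) (w.adicCompletion L) = 2)
    {ϖ : v.adicCompletionIntegers K} (hϖ : Irreducible ϖ)
    (hinert : Irreducible (algebraMap (v.adicCompletionIntegers K) (w.adicCompletionIntegers L) ϖ))
    (σ : w.adicCompletion L ≃ₐ[v.adicCompletion K] w.adicCompletion L) (hσ : σ ≠ 1) :
    letI := T5StarOfInvolution.starRingOfQuadratic h2 σ hσ
    ∀ {H : Matrix (Fin 3) (Fin 3) (w.adicCompletion L)}, H.IsHermitian → IsUnit H.det →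
    ((∃ Q : Matrix (Fin 3) (Fin 3) (w.adicCompletion L), IsUnit Q ∧
      T5UnitaryGroupIsometry.dualLattice
        (integralClosure (v.adicCompletionIntegers K) (w.adicCompletion L))
        (Q.conjTranspose * H * Q)
        (T5UnitaryGroupIsometry.stdLattice
          (integralClosure (v.adicCompletionIntegers K) (w.adicCompletion L))) =
      T5UnitaryGroupIsometry.stdLattice
        (integralClosure (v.adicCompletionIntegers K) (w.adicCompletion L))) ↔
    ∃ (a : (v.adicCompletionIntegers K)ˣ) (m : ℤ),
      H.det = algebraMap (v.adicCompletionIntegers K) (w.adicCompletion L) a *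
        algebraMap (v.adicCompletionIntegers K) (w.adicCompletion L) ϖ ^ (2 * m)) := by
  intro H hH hdet
  obtain ⟨x, hx, hiso⟩ := exists_isotropic_adicCompletion v w h2 hϖ hinert σ hσ hH hdet
  exact T5InertPlaceCompletionLattice.exists_dualLattice_eq_iff_exists_det_eq_mul_zpow_adicCompletion
    v w h2 hϖ hinert σ hσ hH hdet hx hiso

/-- (u3) with the lattice over Mathlib's own `O_Lw`, without an isotropy hypothesis. -/
theorem exists_dualLattice_eq_iff_exists_det_eq_mul_zpow_of_isUnit_det'
    (h2 : Module.finrank (v.adicCompletion K) (w.adicCompletion L) = 2)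
    {ϖ : v.adicCompletionIntegers K} (hϖ : Irreducible ϖ)
    (hinert : Irreducible (algebraMap (v.adicCompletionIntegers K) (w.adicCompletionIntegers L) ϖ))
    (σ : w.adicCompletion L ≃ₐ[v.adicCompletion K] w.adicCompletion L) (hσ : σ ≠ 1) :
    letI := T5StarOfInvolution.starRingOfQuadratic h2 σ hσ
    ∀ {H : Matrix (Fin 3) (Fin 3) (w.adicCompletion L)}, H.IsHermitian → IsUnit H.det →
    ((∃ Q : Matrix (Fin 3) (Fin 3) (w.adicCompletion L), IsUnit Q ∧
      T5UnitaryGroupIsometry.dualLattice (w.adicCompletionIntegers L) (Q.conjTranspose * H * Q)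
        (T5UnitaryGroupIsometry.stdLattice (w.adicCompletionIntegers L)) =
      T5UnitaryGroupIsometry.stdLattice (w.adicCompletionIntegers L)) ↔
    ∃ (a : (v.adicCompletionIntegers K)ˣ) (m : ℤ),
      H.det = algebraMap (v.adicCompletionIntegers K) (w.adicCompletion L) a *
        algebraMap (v.adicCompletionIntegers K) (w.adicCompletion L) ϖ ^ (2 * m)) := by
  intro H hH hdet
  obtain ⟨x, hx, hiso⟩ := exists_isotropic_adicCompletion v w h2 hϖ hinert σ hσ hH hdet
  exact T5InertPlaceCompletionLattice.exists_dualLattice_eq_iff_exists_det_eq_mul_zpow_adicCompletion'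
    v w h2 hϖ hinert σ hσ hH hdet hx hiso

/-- `H(U(H), K_H)` is commutative for every `σ`-hermitian `H` over `L_w` with unit determinant and
integral entries and inverse — the isotropy hypothesis of
`T5InertPlaceCompletion.heckeAlgebra_mul_comm_adicCompletion` discharged. -/
theorem heckeAlgebra_mul_comm_of_isUnit_det
    (h2 : Module.finrank (v.adicCompletion K) (w.adicCompletion L) = 2)
    {ϖ : v.adicCompletionIntegers K} (hϖ : Irreducible ϖ)
    (hinert : Irreducible (algebraMap (v.adicCompletionIntegers K) (w.adicCompletionIntegers L) ϖ))
    (σ : w.adicCompletion L ≃ₐ[v.adicCompletion K] w.adicCompletion L) (hσ : σ ≠ 1) :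
    letI := T5StarOfInvolution.starRingOfQuadratic h2 σ hσ
    ∀ (H : Matrix (Fin 3) (Fin 3) (w.adicCompletion L)) (k : Type*) [Field k],
      H.IsHermitian →
      (∀ i j, IsLocalization.IsInteger
        (integralClosure (v.adicCompletionIntegers K) (w.adicCompletion L)) (H i j)) →
      IsUnit H.det →
      (∀ i j, IsLocalization.IsInteger
        (integralClosure (v.adicCompletionIntegers K) (w.adicCompletion L)) (H⁻¹ i j)) →
      ∀ (T S : T5HeckePermutationModule.heckeAlgebra k (T5UnitaryHeckeAdjoint.hyperspecialSubgroup
        (integralClosure (v.adicCompletionIntegers K) (w.adicCompletion L)) H)),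
      T * S = S * T := by
  intro H k _ hH hint hdet hinv T S
  obtain ⟨x, hx, hiso⟩ := exists_isotropic_adicCompletion v w h2 hϖ hinert σ hσ hH hdet
  exact T5InertPlaceCompletion.heckeAlgebra_mul_comm_adicCompletion v w h2 hϖ hinert σ hσ H k hH
    hint hdet hinv x hx hiso T S

end Summit.Ventures.HodgeRepro2.T5InertPlaceCompletionIsotropy
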